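import Literature.MathematicalPhysics.QuantumFieldTheory.Balaban1983to89.B13Lemma3Torus

/-!
# `Balaban1983to89.B13Lemma3TorusTerms` — T. Bałaban, *Renormalization group approach to lattice gauge field theories.
II. Cluster expansions*, Commun. Math. Phys. **116** (1988) 1–22 [Balaban1988RG2Cluster]: the resummation pp. 17–20
proving Lemma 3, FROM (2.26) FOR EVERY TERM, ON THE PAPERS' PERIODIC CARRIER — the printed term set (𝐃, P) of the
activity H(Z) INJECTED into the majorant of `B13Lemma3Torus.bound238With_torus` on the two-scale TORUS model, so
that (2.38) AS PRINTED on the torus follows from the per-term bound (2.26) and the restrictions on the constants alone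
(`bound238_torus_of_226`), and §2 end to end on the torus from the termwise (2.26) (`deliverables_torus_termwise_of_226`)

statement-level skeleton of published theorems with citation tags; proofs where landed; nothing here is a claim about
the Yang–Mills mass gap

PDF held: `paper:balaban1988-cmp116-rg-ii-cluster` (journal page = PDF page + 0); pp. 12–20 re-read this session from
the text layer `p0012.txt`–`p0020.txt` of that key; the sentences used are quoted verbatim in the docstrings below.

CITATION HEADER / WHAT IS REPRODUCED (unit `lit-balaban-r10` gen 10, B13 fold owner; SKELETON rows `B13.Eq2.26`,
`B13.Eq2.35`, `B13.Eq2.37`, `B13.Eq2.38`, `B13.Lem3` of `HOME/lit-balaban-r10/ROWS-B13.md`, HOME =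
`run/shared/lean/pub/lit-balaban/`; kind «model-instance on the torus»).  This module is the TORUS twin of
`B13Lemma3WindowTerms` (r10 gen 6, window model): `B13Lemma3Assembly.bound238With_of_226` and its torus instance
`B13Lemma3Torus.bound238_torus` take the analytic input (2.26) in RESUMMED form (`hrep`); print states (2.26) PER TERM
(𝐃, P) of (2.9)/(2.14) and then resums (p. 17, verbatim): *"To get a bound for H(Z) we have to perform the
resummation of the terms (2.14) over 𝐃, P and Z₀. We do it in the following order. For a fixed Y₀ we sum over all 𝐃
satisfying (2.2). Next, we sum over Y₀, P determining a fixed Z₀. Further, for a fixed Z′₀, we sum over all possible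
Z₀ determining this fixed Z′₀. Finally we sum over all Z′₀ ⊂ Z."*  HERE that passage is PROVED for the torus model as
`sum_weight_le_majorant`: the sum of the (2.26)-weights over ALL terms (𝐃, P) of H(Z) is bounded by the majorant — by
realizing the term ↦ (Z′₀; Z′_i; families; component sets; (Y₀ ∩ Z_i, P ∩ Z_i, 𝐃_i)) map as an INJECTION with
multiplicative weights (pp. 17–18, verbatim: *"The sum over 𝐃 factorizes into independent sums over 𝐃_i, similarly
the product over Y∈𝐃 in (2.26) factorizes into products over Y∈𝐃_i"*; p. 19: *"A sum over n components is estimated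
by a product of n sums, each of them is a sum over independently changing components"*), through one generic
injection-into-a-product bound and fiberwise sums at the three printed levels (`sum_terms_le`, `step2`, `step1`,
`sum_admA_le`).  OBJECTS (cubes = members of the periodic index model `TreeLengthTorus.TPt d (L·N′)`, bonds = the unit
torus bonds `B13Lemma3TorusData.TBond d M (L·N′)`, components = `B13Ineq232Torus.tcomp/tcomps`, closure Z ↦ Z′ =
`TreeLengthTorusTransfer.tclosure L N′`): `IsTerm`/`terms` (𝐃 ⊂ 𝐃_k, P ⊂ torus bonds not inside Y₀, Z₀ := Y₀ ∪
{endpoint cubes of P} ≠ ∅ — the cell's reading of p. 12/p. 18, transcript G7 — and Z′₀ ⊆ Z), `weight` (the right side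
of (2.26) without exp O(1)α₅|Z|), `compsD`/`restr`, `innerIdx`/`omega`/`inner` (`innerSum_eq`).  THEOREMS:
`tclosure_eq_biUnion_tcomps`, `restr_mem_innerIdx`, `weight_factor`, `eq_of_restr_eq`, `sum_terms_le`, `step2`,
`step1`, `sum_admA_le`, **`sum_weight_le_majorant`**, **`hrep_of_termwise`**, **`bound238_torus_of_226`** (d = 4, L =
`c.L` ≥ 8: (2.38) AS PRINTED `B13.Bound238 W.toStepData c` on the torus from (2.26) per term and the restrictions on
the constants), **`deliverables_torus_termwise_of_226`** (§2 end to end on the torus from the termwise (2.26)).  No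
`sorry`, no new named fact (D-0026); Mathlib + `B13Lemma3Torus` only.

HONEST SCOPE.  (i) What stays by assertion is exactly the ANALYTIC content of the printed proof: the representation of
H(Z) by its terms ((2.9)/(2.14), hypothesis `hH`, stated as domination ‖H(Z)‖ ≤ Σ_t ‖T_t‖) and the per-term bound
(2.26) ← (2.15)–(2.25) (hypothesis `h226`).  (ii) The term set over-counts print's (tree-gauge bonds b₀(c) not
excluded; "not inside Y₀" read on endpoint cubes) — harmless: extra terms may carry T_t = 0.  (iii) Z₀ := Y₀ ∪
{endpoint cubes of P} is the cell's reading (transcript G7, as in `B13Lemma3Assembly`'s `htouch` ≤ 2).  (iv) The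
weight's first factor counts the LM-cubes of Z∖Z′₀ for THIS Z′₀; constants as in `B13Lemma3Torus` (HONEST SCOPE there:
c₃₂ = 18 on the torus).  Value = kernel-checked bookkeeping: the TORUS-model Lemma 3 — and §2 on the torus — now rest
on (2.26) per term and numbers only (plus the located leaves (2.13), space restriction, log-half, predicates).
-/

namespace Literature.MathematicalPhysics.QuantumFieldTheory.Balaban1983to89.B13Lemma3TorusTerms

open Literature.MathematicalPhysics.QuantumFieldTheory.Balaban1983to89
open Literature.MathematicalPhysics.QuantumFieldTheory.Balaban1983to89.TreeLengthTorus
open Literature.MathematicalPhysics.QuantumFieldTheory.Balaban1983to89.TreeLengthTorusGeometry (TTouch)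
open Literature.MathematicalPhysics.QuantumFieldTheory.Balaban1983to89.TreeLengthTorusTransfer
  (tcoarse tadj_tcoarse tblock tcollar tclosure tclosureDom tclosureDom_val)
open Literature.MathematicalPhysics.QuantumFieldTheory.Balaban1983to89.B12TreeDecay (kappa₀ K₀)
open Literature.MathematicalPhysics.QuantumFieldTheory.Balaban1983to89.B13Geometry236Printed (a236c)
open Literature.MathematicalPhysics.QuantumFieldTheory.Balaban1983to89.B13Ineq232Torus
open Literature.MathematicalPhysics.QuantumFieldTheory.Balaban1983to89.B13Lemma3TorusData
open Literature.MathematicalPhysics.QuantumFieldTheory.Balaban1983to89.B13Lemma3Assembly (innerSum compSum famSum admP)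
open Literature.MathematicalPhysics.QuantumFieldTheory.Balaban1983to89.B13Lemma3Torus
  (J I cc wZ dI isTDom_I TwoTorusStep bound238_torus deliverables_torus_of_226)
open Literature.MathematicalPhysics.QuantumFieldTheory.Balaban1983to89.B13Resummation (locE)

noncomputable section

variable {d : ℕ}

/-! ## §1. A generic injection-into-a-product bound -/

/-- A generic INJECTION-INTO-A-PRODUCT bound (the combinatorial shape of every resummation step of pp. 17–20: *"A sum
over n components is estimated by a product of n sums, each of them is a sum over independently changing
components"*, p. 19): if every `a ∈ S` is determined by its coordinates `φ a i ∈ T i` (i ∈ s) and its weight is at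
most the product of the coordinate weights (all ≥ 0), then `Σ_{a∈S} w a ≤ Π_{i∈s} Σ_{b∈T i} h i b` (`Finset.prod_sum`
+ a sum over the image of an injection); private plumbing (verbatim the window file's). [folklore] -/
private theorem sum_le_prod_sum {α ι β : Type*} (S : Finset α) (s : Finset ι) (T : ι → Finset β)
    (h : ι → β → ℝ) (hh : ∀ i ∈ s, ∀ b ∈ T i, 0 ≤ h i b) (φ : α → ι → β)
    (hφ : ∀ a ∈ S, ∀ i ∈ s, φ a i ∈ T i)
    (hinj : ∀ a ∈ S, ∀ a' ∈ S, (∀ i ∈ s, φ a i = φ a' i) → a = a')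
    (w : α → ℝ) (hw : ∀ a ∈ S, w a ≤ ∏ i ∈ s, h i (φ a i)) :
    ∑ a ∈ S, w a ≤ ∏ i ∈ s, ∑ b ∈ T i, h i b := by
  classical
  rw [Finset.prod_sum]
  set ψ : α → ((i : ι) → i ∈ s → β) := fun a i _ => φ a i with hψ
  have hψinj : ∀ a ∈ S, ∀ a' ∈ S, ψ a = ψ a' → a = a' := by
    intro a ha a' ha' heq
    refine hinj a ha a' ha' fun i hi => ?_
    have := congrFun (congrFun heq i) hi
    simpa [hψ] using this
  calc ∑ a ∈ S, w a ≤ ∑ a ∈ S, ∏ i ∈ s, h i (φ a i) := Finset.sum_le_sum hw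
    _ = ∑ a ∈ S, ∏ x ∈ s.attach, h x.1 (ψ a x.1 x.2) := by
        refine Finset.sum_congr rfl fun a _ => ?_
        exact (Finset.prod_attach s (fun i => h i (φ a i))).symm
    _ = ∑ p ∈ S.image ψ, ∏ x ∈ s.attach, h x.1 (p x.1 x.2) := by
        rw [Finset.sum_image hψinj]
    _ ≤ ∑ p ∈ s.pi T, ∏ x ∈ s.attach, h x.1 (p x.1 x.2) := by
        refine Finset.sum_le_sum_of_subset_of_nonneg ?_ fun p hp _ => ?_
        · intro p hp
          obtain ⟨a, ha, rfl⟩ := Finset.mem_image.1 hp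
          exact Finset.mem_pi.2 fun i hi => hφ a ha i hi
        · exact Finset.prod_nonneg fun x _ => hh x.1 x.2 _ ((Finset.mem_pi.1 hp) x.1 x.2)

/-! ## §2. Torus components: small complements -/

section Components

variable {N : ℕ}

/-- A torus component is closed under torus wall-adjacency inside `Z`; private plumbing. [folklore] -/
private theorem mem_tcomp_of_tadj {Z : Finset (TPt d N)} {a x y : TPt d N} (hx : x ∈ tcomp Z a) (hy : y ∈ Z)
    (hxy : TAdj x y) : y ∈ tcomp Z a := by
  obtain ⟨hxZ, hax⟩ := mem_tcomp.1 hx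
  exact mem_tcomp.2 ⟨hy, hax.tail ⟨hxZ, hy, hxy⟩⟩

/-- A connected family inside `Z` meeting a component lies inside it
(`B13Ineq232Torus.subset_tcomp_of_tFaceConnected`); private plumbing. [folklore] -/
private theorem subset_tcomp_of_mem {Y Z : Finset (TPt d N)} (hYc : TFaceConnected Y) (hYZ : Y ⊆ Z) {x a : TPt d N}
    (hx : x ∈ Y) (hxa : x ∈ tcomp Z a) : Y ⊆ tcomp Z a := by
  rw [← tcomp_eq_of_mem hxa]
  exact subset_tcomp_of_tFaceConnected hYc hYZ hx

/-- The component of a cube of `Z` is one of the components of `Z`; private plumbing. [folklore] -/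
private theorem tcomp_mem_tcomps {Z : Finset (TPt d N)} {x : TPt d N} (hx : x ∈ Z) : tcomp Z x ∈ tcomps Z :=
  mem_tcomps.2 ⟨x, hx, rfl⟩

end Components

/-! ## §3. The closure Z ↦ Z′ distributes over unions (torus) -/

section Closure

variable {L N' : ℕ} [NeZero L] [NeZero N']

omit [NeZero L] [NeZero N'] in
/-- X̃ of a union is the union of the X̃ (`tcollar` is a `biUnion` of the torus blocks □̃); private plumbing. [folklore] -/
private theorem tcollar_biUnion {ι : Type*} [DecidableEq ι] (F : Finset ι) (g : ι → Finset (TPt d (L * N'))) :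
    tcollar (F.biUnion g) = F.biUnion fun i => tcollar (g i) := by
  classical
  unfold tcollar
  exact Finset.biUnion_biUnion F g tblock

omit [NeZero L] [NeZero N'] in
/-- The family of LM-cubes met by a union is the union of the families; private plumbing. [folklore] -/
private theorem tclosure_biUnion {ι : Type*} [DecidableEq ι] (F : Finset ι) (g : ι → Finset (TPt d (L * N'))) :
    tclosure L N' (F.biUnion g) = F.biUnion fun i => tclosure L N' (g i) := by
  classical
  unfold tclosure
  rw [tcollar_biUnion]
  exact Finset.biUnion_image

omit [NeZero L] [NeZero N'] in
/-- Z′₀ is the union of the closures Z′_i of the torus components Z_i of Z₀ — p. 13 *"Z′₀ is a union of the smallest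
family of such cubes containing Z̃₀"* with p. 19 *"Z₀ = ∪_i Z_i, and we denote by Z′_i the smallest localization domain
from 𝐃_{k+1} containing Z̃_i"* (`B13Ineq232Torus.biUnion_tcomps` + distributivity of X ↦ X̃ ↦ X′ over unions); window
version `B13Lemma3WindowTerms.closure_eq_biUnion_compsF`. [cite: Balaban1988RG2Cluster, p.13 and p.19 (Z′₀ and the Z′_i)] -/
theorem tclosure_eq_biUnion_tcomps (Z : Finset (TPt d (L * N'))) :
    tclosure L N' Z = (tcomps Z).biUnion fun K => tclosure L N' K := by
  classical
  conv_lhs => rw [← biUnion_tcomps Z]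
  rw [show ((tcomps Z).biUnion id) = (tcomps Z).biUnion (fun K => K) from rfl, tclosure_biUnion]

end Closure

/-! ## §4. The terms (𝐃, P) of H(Z) on the torus model and their data -/

section Terms

variable {M : ℕ} [NeZero M] {N : ℕ} [NeZero N]

omit [NeZero M] [NeZero N] in
/-- The initial cube is one of the two cubes met by a bond of the unit torus (`B13Lemma3TorusData.ttouch` = the
M-cubes of the two endpoints); private plumbing. [folklore] -/
private theorem fst_mem_ttouch (b : TBond d M N) : tcoarse M N b.1 ∈ ttouch M N b := Finset.mem_insert_self _ _

omit [NeZero M] [NeZero N] in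
/-- The end cube is one of the two cubes; private plumbing. [folklore] -/
private theorem end_mem_ttouch (b : TBond d M N) : tcoarse M N (tbondEnd b) ∈ ttouch M N b :=
  Finset.mem_insert_of_mem (Finset.mem_singleton_self _)

/-- The two cubes of a torus bond coincide or have a common torus wall (`TreeLengthTorusTransfer.tadj_tcoarse` on the
wall ⟨y, y + e_μ⟩ of the unit torus; *"bonds never cross a corner"*); private plumbing. [folklore] -/
private theorem ttouch_cases (b : TBond d M N) :
    tcoarse M N (tbondEnd b) = tcoarse M N b.1 ∨ TAdj (tcoarse M N b.1) (tcoarse M N (tbondEnd b)) := by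
  rcases tadj_tcoarse (L := M) (N' := N) (tadj_update_add_one b.1 b.2) with h | h
  · left; rw [tbondEnd]; exact h.symm
  · right; rw [tbondEnd]; exact h

omit [NeZero M] [NeZero N] in
/-- Membership in the two-cube set; private plumbing. [folklore] -/
private theorem mem_ttouch_iff {b : TBond d M N} {x : TPt d N} :
    x ∈ ttouch M N b ↔ x = tcoarse M N b.1 ∨ x = tcoarse M N (tbondEnd b) := by
  simp [ttouch]

variable (M N) in
/-- The M-cubes of the torus met by the bonds of P (endpoint cubes): Z₀∖Y₀ ⊆ these — p. 12 *"For a given set P we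
take the smallest localization domain Z₀ ∈ 𝐃_k containing Y₀ and P"*, in the cell's reading of p. 18 (a bond meets the
≤ 2 cubes of its endpoints, transcript G7, `B13MayerDecoupling.card_le_two_mul_card_of_cover`); window version
`B13Lemma3WindowTerms.cubesP`. [cite: Balaban1988RG2Cluster, p.12 (before (2.4)) and p.18 (before (2.31))] -/
def cubesP (P : Finset (TBond d M N)) : Finset (TPt d N) := P.biUnion (ttouch M N)

/-- (2.2) p. 12, verbatim: *"Each term in the sum over subfamilies 𝐃 has the underintegral expression localized in
the domain Y₀ = ∪_{Y∈𝐃} Y"* — as a family of cubes of the torus. [cite: Balaban1988RG2Cluster, (2.2) p.12] -/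
def Y0 (D : Finset (TDom d N)) : Finset (TPt d N) := D.biUnion fun Y => Y.1

variable (M) in
/-- Z₀ of a term (𝐃, P) on the torus: p. 12 *"the smallest localization domain Z₀ ∈ 𝐃_k containing Y₀ and P"*, p. 18
*"In general the set Z₀ is a union of connected components"* — in the cell's reading Z₀ = Y₀ ∪ {endpoint cubes of
the bonds of P} (transcript G7; the reading under which p. 18's *"one bond in P may connect two cubes in Z₀∖Y₀"*
holds); window version `B13Lemma3WindowTerms.Z0`. [cite: Balaban1988RG2Cluster, p.12 (before (2.4)) and p.18 (before (2.31))] -/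
def Z0 (t : Finset (TDom d N) × Finset (TBond d M N)) : Finset (TPt d N) := Y0 t.1 ∪ cubesP M N t.2

omit [NeZero M] in
/-- The cubes of a bond of P are cubes of Z₀; private plumbing. [folklore] -/
private theorem ttouch_subset_Z0 {t : Finset (TDom d N) × Finset (TBond d M N)} {b : TBond d M N} (hb : b ∈ t.2) :
    ttouch M N b ⊆ Z0 M t :=
  fun _ hx => Finset.mem_union_right _ (Finset.mem_biUnion.2 ⟨b, hb, hx⟩)

omit [NeZero M] in
/-- A member of 𝐃 lies in Z₀; private plumbing. [folklore] -/
private theorem val_subset_Z0 {t : Finset (TDom d N) × Finset (TBond d M N)} {Y : TDom d N} (hY : Y ∈ t.1) :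
    Y.1 ⊆ Z0 M t :=
  fun _ hx => Finset.mem_union_left _ (Finset.mem_biUnion.2 ⟨Y, hY, hx⟩)

/-! ### The components of Z₀ as scale-k torus domains, and the restriction of a term to a component -/

variable (M) in
open Classical in
/-- The connected components Z_i of Z₀ as 𝐃_k-domains of the torus — p. 18/19, verbatim: *"In general the set Z₀ is
a union of connected components. Let us denote one of the components by Z₀."* / *"The set Z₀ is a union of connected
components, Z₀ = ∪_i Z_i"* (`B13Ineq232Torus.tcomps`); window version `B13Lemma3WindowTerms.compsD`.
[cite: Balaban1988RG2Cluster, p.18 (before (2.32)) and (2.35) p.19] -/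
def compsD (t : Finset (TDom d N) × Finset (TBond d M N)) : Finset (TDom d N) :=
  Finset.univ.filter fun Zc : TDom d N => Zc.1 ∈ tcomps (Z0 M t)

omit [NeZero M] in
/-- Membership in `compsD`; private plumbing. [folklore] -/
private theorem mem_compsD {t : Finset (TDom d N) × Finset (TBond d M N)} {Zc : TDom d N} :
    Zc ∈ compsD M t ↔ Zc.1 ∈ tcomps (Z0 M t) := by
  classical
  simp [compsD]

/-- The component of a cube of Z₀ of a term, as a 𝐃_k-domain of the torus (`B13Ineq232Torus.isTDom_tcomp`); private
plumbing. [folklore] -/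
private def compAt (t : Finset (TDom d N) × Finset (TBond d M N)) {x : TPt d N} (hx : x ∈ Z0 M t) : TDom d N :=
  ⟨tcomp (Z0 M t) x, isTDom_tcomp hx⟩

omit [NeZero M] in
/-- It is one of the components; private plumbing. [folklore] -/
private theorem compAt_mem (t : Finset (TDom d N) × Finset (TBond d M N)) {x : TPt d N} (hx : x ∈ Z0 M t) :
    compAt t hx ∈ compsD M t :=
  mem_compsD.2 (tcomp_mem_tcomps hx)

omit [NeZero M] in
/-- It contains the cube; private plumbing. [folklore] -/
private theorem mem_compAt (t : Finset (TDom d N) × Finset (TBond d M N)) {x : TPt d N} (hx : x ∈ Z0 M t) :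
    x ∈ (compAt t hx).1 :=
  mem_tcomp_self hx

/-- The part Y₀ ∩ Z_i of Y₀ in a component (p. 18: *"For simplicity let us denote by Y₀ one of the components"*; p. 18:
the component Z₀ *"contains Y₀ = ∪_i Y_i"*), as cubes of the torus. [cite: Balaban1988RG2Cluster, p.17–18 (decomposition of Y₀ and 𝐃)] -/
def rY (t : Finset (TDom d N) × Finset (TBond d M N)) (Zc : TDom d N) : Finset (TPt d N) := Y0 t.1 ∩ Zc.1

open Classical in
/-- The bonds of P in a component (those whose initial cube lies in it; both cubes then do, `ttouch_subset_comp`) —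
the P-part of the restriction of a term to a component of Z₀ (p. 18: the |P|-factor of (2.26) is used component by
component in (2.31)–(2.33)). [cite: Balaban1988RG2Cluster, p.18 (the sum over Y₀, P with fixed Z₀)] -/
def rP (t : Finset (TDom d N) × Finset (TBond d M N)) (Zc : TDom d N) : Finset (TBond d M N) :=
  t.2.filter fun b => tcoarse M N b.1 ∈ Zc.1

open Classical in
/-- The members of 𝐃 inside a component — pp. 17–18, verbatim: *"this decomposition induces the decomposition of the
families 𝐃, 𝐃 = ∪_i 𝐃_i, 𝐃_i satisfy ∪_{Y∈𝐃_i} Y = Y_i. The sum over 𝐃 factorizes into independent sums over 𝐃_i,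
similarly the product over Y∈𝐃 in (2.26) factorizes into products over Y∈𝐃_i"*. [cite: Balaban1988RG2Cluster, p.17–18 (decomposition of 𝐃)] -/
def rD (t : Finset (TDom d N) × Finset (TBond d M N)) (Zc : TDom d N) : Finset (TDom d N) :=
  t.1.filter fun Y => Y.1 ⊆ Zc.1

variable (M) in
/-- The index set of the per-component sum `B13Lemma3Assembly.innerSum` on the torus (over Y₀ ⊆ Z_i, admissible P among
the available torus bonds `B13Lemma3TorusData.tavail`, covering families 𝐃 of Y₀) as ONE finite set of triples
(Y₀, P, 𝐃) (`innerSum_eq`). [cite: Balaban1988RG2Cluster, (2.26) p.17 and p.17 (resummation order)] -/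
def innerIdx (Zc : TDom d N) : Finset (Σ _ : Finset (TPt d N), Finset (TBond d M N) × Finset (TDom d N)) :=
  Zc.1.powerset.sigma fun Y₀ =>
    admP Zc.1 (ttouch M N) (tavail M N Zc Y₀) Y₀ ×ˢ
      B13FamilySum.coveringFamilies (Finset.univ : Finset (TDom d N)) (fun Y : TDom d N => Y.1) Y₀

/-- The (2.26)-weight of one triple (Y₀, P, 𝐃) of a component: Π_{Y∈𝐃} α₆ε₂e^{−(1−3δ)κd_k(Y)} · e^{−(a/2)|P|} (α₆ε₂ =
2E₀ε₁C₁α₄⁻¹M^q exp C₂κ₁ by the definition of ε₂ p. 19; a = γ₂ε₁²/g_k²; d_k = `torusTreeLen`) — the summand of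
`innerSum`. [cite: Balaban1988RG2Cluster, (2.26) p.17] -/
def omega (c : B13.Consts) (a : ℝ) (x : Σ _ : Finset (TPt d N), Finset (TBond d M N) × Finset (TDom d N)) : ℝ :=
  (∏ Y ∈ x.2.2, (c.α₆ * c.eps2 * Real.exp (-((1 - 3 * c.δ) * c.κ * (tsys d N).dj Y)))) *
    Real.exp (-(a / 2 * (x.2.1.card : ℝ)))

omit [NeZero M] in
/-- The weights are non-negative; private plumbing. [folklore] -/
private theorem omega_nonneg (c : B13.Consts) (a : ℝ) (hA : 0 ≤ c.α₆ * c.eps2)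
    (x : Σ _ : Finset (TPt d N), Finset (TBond d M N) × Finset (TDom d N)) : 0 ≤ omega c a x :=
  mul_nonneg (Finset.prod_nonneg fun _ _ => mul_nonneg hA (Real.exp_nonneg _)) (Real.exp_nonneg _)

/-- `B13Lemma3Assembly.innerSum` on the torus data IS the sum of `omega` over `innerIdx` (`Finset.sum_sigma`,
`Finset.sum_product`). [cite: Balaban1988RG2Cluster, (2.26) p.17 and p.17 (resummation order)] -/
theorem innerSum_eq (c : B13.Consts) (a : ℝ) (Zc : TDom d N) :
    innerSum (Finset.univ : Finset (TDom d N)) (fun Y : TDom d N => Y.1) (tsys d N).dj Zc.1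
      (ttouch M N) (tavail M N Zc) (c.α₆ * c.eps2) ((1 - 3 * c.δ) * c.κ) a =
      ∑ x ∈ innerIdx M Zc, omega c a x := by
  unfold innerSum innerIdx
  rw [Finset.sum_sigma]
  refine Finset.sum_congr rfl fun Y₀ _ => ?_
  rw [Finset.sum_product]
  rfl

/-- The restriction of a term (𝐃, P) to a component Z_i of Z₀: (Y₀ ∩ Z_i, P ∩ bonds of Z_i, 𝐃_i) — the data summed
*"over Y₀, P determining a fixed Z₀"* for ONE component (pp. 17–18). [cite: Balaban1988RG2Cluster, p.17–18 (decomposition of Y₀ and 𝐃)] -/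
def restr (t : Finset (TDom d N) × Finset (TBond d M N)) (Zc : TDom d N) :
    Σ _ : Finset (TPt d N), Finset (TBond d M N) × Finset (TDom d N) :=
  ⟨rY t Zc, (rP t Zc, rD t Zc)⟩

/-! ### The restriction lands in the index set of `innerSum` -/

/-- Both cubes of a bond of P lie in the component of its initial cube (they coincide or share a torus wall); private
plumbing. [folklore] -/
private theorem ttouch_subset_comp {t : Finset (TDom d N) × Finset (TBond d M N)} {b : TBond d M N} (hb : b ∈ t.2)
    {Zc : TDom d N} (hZc : Zc ∈ compsD M t) (h1 : tcoarse M N b.1 ∈ Zc.1) : ttouch M N b ⊆ Zc.1 := by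
  obtain ⟨a, -, haZ⟩ := mem_tcomps.1 (mem_compsD.1 hZc)
  intro x hx
  rcases mem_ttouch_iff.1 hx with rfl | rfl
  · exact h1
  · rw [← haZ] at h1 ⊢
    rcases ttouch_cases (M := M) (N := N) b with h | h
    · rw [h]; exact h1
    · exact mem_tcomp_of_tadj h1 (ttouch_subset_Z0 hb (end_mem_ttouch b)) h

/-- A bond of P whose end cube lies in a component has its initial cube there; private plumbing. [folklore] -/
private theorem fst_mem_of_end_mem {t : Finset (TDom d N) × Finset (TBond d M N)} {b : TBond d M N} (hb : b ∈ t.2)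
    {Zc : TDom d N} (hZc : Zc ∈ compsD M t) (h2 : tcoarse M N (tbondEnd b) ∈ Zc.1) : tcoarse M N b.1 ∈ Zc.1 := by
  obtain ⟨a, -, haZ⟩ := mem_tcomps.1 (mem_compsD.1 hZc)
  rw [← haZ] at h2 ⊢
  rcases ttouch_cases (M := M) (N := N) b with h | h
  · rw [← h]; exact h2
  · exact mem_tcomp_of_tadj h2 (ttouch_subset_Z0 hb (fst_mem_ttouch b)) h.symm

omit [NeZero M] in
/-- A member of 𝐃 meeting a component lies inside it; private plumbing. [folklore] -/
private theorem val_subset_comp {t : Finset (TDom d N) × Finset (TBond d M N)} {Y : TDom d N} (hY : Y ∈ t.1)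
    {Zc : TDom d N} (hZc : Zc ∈ compsD M t) {x : TPt d N} (hxY : x ∈ Y.1) (hxZ : x ∈ Zc.1) : Y.1 ⊆ Zc.1 := by
  obtain ⟨a, -, haZ⟩ := mem_tcomps.1 (mem_compsD.1 hZc)
  rw [← haZ] at hxZ ⊢
  exact subset_tcomp_of_mem Y.2.2 (val_subset_Z0 hY) hxY hxZ

/-- **The restriction of a term to a component Z_i of Z₀ is one of the triples summed in `innerSum`** (torus): Y₀ ∩
Z_i ⊆ Z_i; P ∩ bonds(Z_i) is ADMISSIBLE (`B13Lemma3Assembly.admP`: contained in the available torus bonds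
`B13Lemma3TorusData.tavail` — each lies in Z_i and not inside Y₀, `mem_tavail` — and its cubes cover Z_i∖Y₀, p. 18 *"The
definition of Z₀ yields |P| ≧ ½M⁻⁴|Z₀∖Y₀|"*); 𝐃_i covers exactly Y₀ ∩ Z_i (p. 17 *"𝐃_i satisfy ∪_{Y∈𝐃_i} Y = Y_i"*).
Here `hP` is the term condition "no bond of P inside Y₀" ((2.3) p. 12). [cite: Balaban1988RG2Cluster, p.17–18 (decomposition of Y₀ and 𝐃) and p.18 (before (2.31))] -/
theorem restr_mem_innerIdx {t : Finset (TDom d N) × Finset (TBond d M N)} (hP : ∀ b ∈ t.2, ¬ ttouch M N b ⊆ Y0 t.1)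
    {Zc : TDom d N} (hZc : Zc ∈ compsD M t) : restr t Zc ∈ innerIdx M Zc := by
  classical
  unfold innerIdx restr
  rw [Finset.mem_sigma, Finset.mem_powerset, Finset.mem_product]
  refine ⟨fun q hq => (Finset.mem_inter.1 hq).2, ?_, ?_⟩
  · -- P ∩ (bonds of the component) is admissible
    unfold admP
    rw [Finset.mem_filter, Finset.mem_powerset]
    constructor
    · intro b hb
      obtain ⟨hbt, hb1⟩ := Finset.mem_filter.1 hb
      have hsub : ttouch M N b ⊆ Zc.1 := ttouch_subset_comp hbt hZc hb1
      refine mem_tavail Zc (rY t Zc) hsub ?_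
      intro hq
      exact hP b hbt fun x hx => (Finset.mem_inter.1 (hq hx)).1
    · intro q hq
      obtain ⟨hqZ, hqY⟩ := Finset.mem_sdiff.1 hq
      have hqZ0 : q ∈ Z0 M t := by
        obtain ⟨a, -, haZ⟩ := mem_tcomps.1 (mem_compsD.1 hZc)
        rw [← haZ] at hqZ
        exact tcomp_subset _ _ hqZ
      have hqnotY : q ∉ Y0 t.1 := fun h => hqY (Finset.mem_inter.2 ⟨h, hqZ⟩)
      rcases Finset.mem_union.1 hqZ0 with h | h
      · exact absurd h hqnotY
      · obtain ⟨b, hbt, hqb⟩ := Finset.mem_biUnion.1 h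
        have hb1 : tcoarse M N b.1 ∈ Zc.1 := by
          rcases mem_ttouch_iff.1 hqb with h' | h'
          · rw [← h']; exact hqZ
          · exact fst_mem_of_end_mem hbt hZc (h' ▸ hqZ)
        exact Finset.mem_biUnion.2 ⟨b, Finset.mem_filter.2 ⟨hbt, hb1⟩, hqb⟩
  · -- 𝐃 ∩ (domains inside the component) covers Y₀ ∩ component
    rw [B13FamilySum.mem_coveringFamilies]
    refine ⟨Finset.subset_univ _, ?_⟩
    ext q
    rw [Finset.mem_biUnion]
    constructor
    · rintro ⟨Y, hY, hq⟩
      obtain ⟨hYt, hYZ⟩ := Finset.mem_filter.1 hY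
      exact Finset.mem_inter.2 ⟨Finset.mem_biUnion.2 ⟨Y, hYt, hq⟩, hYZ hq⟩
    · intro hq
      obtain ⟨hqY, hqZ⟩ := Finset.mem_inter.1 hq
      obtain ⟨Y, hYt, hqY'⟩ := Finset.mem_biUnion.1 hqY
      exact ⟨Y, Finset.mem_filter.2 ⟨hYt, val_subset_comp hYt hZc hqY' hqZ⟩, hqY'⟩

/-! ### Every member of 𝐃 and every bond of P belongs to exactly one component -/

omit [NeZero M] in
open Classical in
/-- 𝐃 = ∪_i 𝐃_i over the components (p. 17); private plumbing. [folklore] -/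
private theorem fst_eq_biUnion_rD (t : Finset (TDom d N) × Finset (TBond d M N)) :
    t.1 = (compsD M t).biUnion (rD t) := by
  classical
  ext Y
  rw [Finset.mem_biUnion]
  constructor
  · intro hY
    obtain ⟨y, hy⟩ := Y.2.1
    have hyZ : y ∈ Z0 M t := val_subset_Z0 hY hy
    refine ⟨compAt t hyZ, compAt_mem t hyZ, Finset.mem_filter.2 ⟨hY, ?_⟩⟩
    exact val_subset_comp hY (compAt_mem t hyZ) hy (mem_compAt t hyZ)
  · rintro ⟨Zc, -, hY⟩
    exact (Finset.mem_filter.1 hY).1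

omit [NeZero M] in
/-- The 𝐃_i are pairwise disjoint; private plumbing. [folklore] -/
private theorem rD_disjoint {t : Finset (TDom d N) × Finset (TBond d M N)} {Zc Zc' : TDom d N}
    (hZc : Zc ∈ compsD M t) (hZc' : Zc' ∈ compsD M t) (hne : Zc ≠ Zc') : Disjoint (rD t Zc) (rD t Zc') := by
  classical
  rw [Finset.disjoint_left]
  intro Y hY hY'
  obtain ⟨-, h1⟩ := Finset.mem_filter.1 hY
  obtain ⟨-, h2⟩ := Finset.mem_filter.1 hY'
  obtain ⟨y, hy⟩ := Y.2.1
  exact hne (Subtype.ext (eq_of_mem_of_mem_tcomps (mem_compsD.1 hZc) (mem_compsD.1 hZc') (h1 hy) (h2 hy)))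

omit [NeZero M] in
open Classical in
/-- P = ∪_i (P ∩ bonds of Z_i); private plumbing. [folklore] -/
private theorem snd_eq_biUnion_rP (t : Finset (TDom d N) × Finset (TBond d M N)) :
    t.2 = (compsD M t).biUnion (rP t) := by
  classical
  ext b
  rw [Finset.mem_biUnion]
  constructor
  · intro hb
    have h1 : tcoarse M N b.1 ∈ Z0 M t := ttouch_subset_Z0 hb (fst_mem_ttouch b)
    exact ⟨compAt t h1, compAt_mem t h1, Finset.mem_filter.2 ⟨hb, mem_compAt t h1⟩⟩
  · rintro ⟨Zc, -, hb⟩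
    exact (Finset.mem_filter.1 hb).1

omit [NeZero M] in
/-- The P-parts are pairwise disjoint; private plumbing. [folklore] -/
private theorem rP_disjoint {t : Finset (TDom d N) × Finset (TBond d M N)} {Zc Zc' : TDom d N}
    (hZc : Zc ∈ compsD M t) (hZc' : Zc' ∈ compsD M t) (hne : Zc ≠ Zc') : Disjoint (rP t Zc) (rP t Zc') := by
  classical
  rw [Finset.disjoint_left]
  intro b hb hb'
  obtain ⟨-, h1⟩ := Finset.mem_filter.1 hb
  obtain ⟨-, h2⟩ := Finset.mem_filter.1 hb'
  exact hne (Subtype.ext (eq_of_mem_of_mem_tcomps (mem_compsD.1 hZc) (mem_compsD.1 hZc') h1 h2))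

omit [NeZero M] in
/-- **The (2.26)-weight of a term FACTORIZES over the torus components of Z₀** — pp. 17–18, verbatim: *"The sum over
𝐃 factorizes into independent sums over 𝐃_i, similarly the product over Y∈𝐃 in (2.26) factorizes into products over
Y∈𝐃_i"*, and |P| = Σ_i |P ∩ bonds(Z_i)|: Π_{Y∈𝐃}(α₆ε₂e^{−(1−3δ)κd_k(Y)})·e^{−(a/2)|P|} = Π_{Z_i} omega(restriction to
Z_i). [cite: Balaban1988RG2Cluster, p.17–18 (factorization over components)] -/
theorem weight_factor (t : Finset (TDom d N) × Finset (TBond d M N)) (c : B13.Consts) (a : ℝ) :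
    (∏ Y ∈ t.1, (c.α₆ * c.eps2 * Real.exp (-((1 - 3 * c.δ) * c.κ * (tsys d N).dj Y)))) *
        Real.exp (-(a / 2 * (t.2.card : ℝ))) =
      ∏ Zc ∈ compsD M t, omega c a (restr t Zc) := by
  classical
  have h1 : ∏ Y ∈ t.1, (c.α₆ * c.eps2 * Real.exp (-((1 - 3 * c.δ) * c.κ * (tsys d N).dj Y))) =
      ∏ Zc ∈ compsD M t, ∏ Y ∈ rD t Zc, (c.α₆ * c.eps2 * Real.exp (-((1 - 3 * c.δ) * c.κ * (tsys d N).dj Y))) := by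
    conv_lhs => rw [fst_eq_biUnion_rD t]
    exact Finset.prod_biUnion fun Zc hZc Zc' hZc' hne => rD_disjoint hZc hZc' hne
  have h2 : (t.2.card : ℝ) = ∑ Zc ∈ compsD M t, ((rP t Zc).card : ℝ) := by
    have hc := Finset.card_biUnion (s := compsD M t) (t := rP t)
      (fun Zc hZc Zc' hZc' hne => rP_disjoint hZc hZc' hne)
    rw [← snd_eq_biUnion_rP t] at hc
    exact_mod_cast hc
  have h3 : Real.exp (-(a / 2 * (t.2.card : ℝ))) =
      ∏ Zc ∈ compsD M t, Real.exp (-(a / 2 * ((rP t Zc).card : ℝ))) := by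
    rw [h2, Finset.mul_sum, ← Finset.sum_neg_distrib, Real.exp_sum]
  rw [h1, h3, ← Finset.prod_mul_distrib]
  rfl

omit [NeZero M] in
/-- 𝐃 is recovered from the 𝐃_i; private plumbing. [folklore] -/
private theorem fst_subset_of_rD {t t' : Finset (TDom d N) × Finset (TBond d M N)}
    (h : ∀ Zc ∈ compsD M t, rD t Zc = rD t' Zc) : t.1 ⊆ t'.1 := by
  classical
  intro Y hY
  obtain ⟨y, hy⟩ := Y.2.1
  have hyZ : y ∈ Z0 M t := val_subset_Z0 hY hy
  have hmem : Y ∈ rD t (compAt t hyZ) :=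
    Finset.mem_filter.2 ⟨hY, val_subset_comp hY (compAt_mem t hyZ) hy (mem_compAt t hyZ)⟩
  rw [h _ (compAt_mem t hyZ)] at hmem
  exact (Finset.mem_filter.1 hmem).1

omit [NeZero M] in
/-- P is recovered from its parts; private plumbing. [folklore] -/
private theorem snd_subset_of_rP {t t' : Finset (TDom d N) × Finset (TBond d M N)}
    (h : ∀ Zc ∈ compsD M t, rP t Zc = rP t' Zc) : t.2 ⊆ t'.2 := by
  classical
  intro b hb
  have h1 : tcoarse M N b.1 ∈ Z0 M t := ttouch_subset_Z0 hb (fst_mem_ttouch b)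
  have hmem : b ∈ rP t (compAt t h1) := Finset.mem_filter.2 ⟨hb, mem_compAt t h1⟩
  rw [h _ (compAt_mem t h1)] at hmem
  exact (Finset.mem_filter.1 hmem).1

omit [NeZero M] in
/-- Equality of restrictions componentwise; private plumbing. [folklore] -/
private theorem restr_eq_iff {t t' : Finset (TDom d N) × Finset (TBond d M N)} {Zc : TDom d N} :
    restr t Zc = restr t' Zc ↔ rY t Zc = rY t' Zc ∧ rP t Zc = rP t' Zc ∧ rD t Zc = rD t' Zc := by
  unfold restr
  rw [Sigma.mk.inj_iff, heq_iff_eq, Prod.mk.injEq]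

omit [NeZero M] in
/-- **A term is determined by its set of components and its restrictions to them** (the injectivity behind *"we sum
over Y₀, P determining a fixed Z₀"*, p. 17: different terms with the same Z₀ differ in some component). [cite: Balaban1988RG2Cluster, p.17 (resummation order)] -/
theorem eq_of_restr_eq {t t' : Finset (TDom d N) × Finset (TBond d M N)} (hA : compsD M t = compsD M t')
    (h : ∀ Zc ∈ compsD M t, restr t Zc = restr t' Zc) : t = t' := by
  have hD : ∀ Zc ∈ compsD M t, rD t Zc = rD t' Zc := fun Zc hZc => (restr_eq_iff.1 (h Zc hZc)).2.2
  have hP : ∀ Zc ∈ compsD M t, rP t Zc = rP t' Zc := fun Zc hZc => (restr_eq_iff.1 (h Zc hZc)).2.1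
  refine Prod.ext (Finset.Subset.antisymm (fst_subset_of_rD hD) (fst_subset_of_rD fun Zc hZc => ?_))
    (Finset.Subset.antisymm (snd_subset_of_rP hP) (snd_subset_of_rP fun Zc hZc => ?_))
  · rw [← hA] at hZc; exact (hD Zc hZc).symm
  · rw [← hA] at hZc; exact (hP Zc hZc).symm

omit [NeZero M] in
/-- A term with Z₀ ≠ ∅ has at least one component; private plumbing. [folklore] -/
private theorem compsD_nonempty {t : Finset (TDom d N) × Finset (TBond d M N)} (hne : (Z0 M t).Nonempty) :
    (compsD M t).Nonempty := by
  obtain ⟨x, hx⟩ := hne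
  exact ⟨compAt t hx, compAt_mem t hx⟩

variable (M) in
/-- The partial (2.26)-sum of ONE torus component of Z₀ — `B13Lemma3Assembly.innerSum` on the torus data of
`B13Lemma3Torus` (cubes = members, d_k = `torusTreeLen`, bonds `ttouch`/`tavail`): Σ_{Y₀ ⊆ Z_i} Σ_{P admissible}
Σ_{𝐃 covering Y₀} omega. [cite: Balaban1988RG2Cluster, (2.26) p.17 and (2.35) p.19] -/
def inner (c : B13.Consts) (a : ℝ) (Zc : TDom d N) : ℝ :=
  innerSum (Finset.univ : Finset (TDom d N)) (fun Y : TDom d N => Y.1) (tsys d N).dj Zc.1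
    (ttouch M N) (tavail M N Zc) (c.α₆ * c.eps2) ((1 - 3 * c.δ) * c.κ) a

/-- The component sums are non-negative; private plumbing. [folklore] -/
private theorem inner_nonneg (c : B13.Consts) (a : ℝ) (hA : 0 ≤ c.α₆ * c.eps2) (Zc : TDom d N) :
    0 ≤ inner M c a Zc :=
  B13Lemma3Assembly.innerSum_nonneg _ _ _ _ _ _ hA

end Terms

/-! ## §5. Two nested tori: the terms of H(Z), Z ∈ 𝐃_{k+1}, and the (2.26)-weights -/

section TwoTori

variable {L N' : ℕ} [NeZero L] [NeZero N'] {M : ℕ} [NeZero M]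

variable (L M) in
/-- The TERMS (𝐃, P) of the activity H(Z), Z ∈ 𝐃_{k+1}, ON THE TORUS (pp. 12–14): 𝐃 ⊂ 𝐃_k a subfamily ((2.1)), P a
set of bonds of the unit torus not inside Y₀ ((2.3): *"Y₀ᶜ = {b ∈ T₁^{(k)} : b ⊄ Y₀} ∖ {b₀(c) : c ∈ T^{(k+1)}}"*; a bond
with both endpoint cubes in Y₀ lies inside Y₀; the tree-gauge bonds b₀(c) are not excluded — over-count), Z₀ ≠ ∅, and
Z′₀ ⊆ Z ((2.9) p. 14: *"H(Z) = Σ_{Z₀ : Z′₀ ⊂ Z} H(Z, Z₀)"*, *"The sums are over Z such, that each connected component of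
Z contains a component of Z′₀"* — for connected Z: Z′₀ ⊆ Z, Z′₀ ≠ ∅), Z′₀ = `tclosure L N′ Z₀`.  The printed term set
injects into this one; window version `B13Lemma3WindowTerms.IsTerm`. [cite: Balaban1988RG2Cluster, (2.1)–(2.3) p.12 and (2.9) p.14] -/
def IsTerm (Z : TDom d N') (t : Finset (TDom d (L * N')) × Finset (TBond d M (L * N'))) : Prop :=
  (∀ b ∈ t.2, ¬ ttouch M (L * N') b ⊆ Y0 t.1) ∧ (Z0 M t).Nonempty ∧ tclosure L N' (Z0 M t) ⊆ Z.1

variable (L M) in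
open Classical in
/-- The finite set of terms (𝐃, P) of H(Z) (`IsTerm`), the index set of *"the sums in (2.9), (2.1), (2.3) over Z₀, 𝐃,
P"* (p. 14) for the torus model. [cite: Balaban1988RG2Cluster, (2.9) p.14 and (2.14) p.15] -/
def terms (Z : TDom d N') : Finset (Finset (TDom d (L * N')) × Finset (TBond d M (L * N'))) :=
  ((Finset.univ : Finset (TDom d (L * N'))).powerset ×ˢ
    (Finset.univ : Finset (TBond d M (L * N'))).powerset).filter (IsTerm L M Z)

/-- Membership in `terms` is `IsTerm` (the universe constraint is automatic on the torus). [cite: Balaban1988RG2Cluster, (2.9) p.14 and (2.14) p.15] -/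
theorem mem_terms {Z : TDom d N'} {t : Finset (TDom d (L * N')) × Finset (TBond d M (L * N'))} :
    t ∈ terms L M Z ↔ IsTerm L M Z t := by
  classical
  unfold terms
  rw [Finset.mem_filter, Finset.mem_product, Finset.mem_powerset, Finset.mem_powerset]
  exact ⟨fun h => h.2, fun h => ⟨⟨Finset.subset_univ _, Finset.subset_univ _⟩, h⟩⟩

omit [NeZero M] in
/-- Z′₀ of a term = the union of the closures Z′_i of its torus components (as `tclosureDom` images) — p. 19 *"we
denote by Z′_i the smallest localization domain from 𝐃_{k+1} containing Z̃_i"*. [cite: Balaban1988RG2Cluster, p.19 (the Z′_i)] -/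
theorem biUnion_closure_compsD (t : Finset (TDom d (L * N')) × Finset (TBond d M (L * N'))) :
    (compsD M t).biUnion (fun Zc => (tclosureDom L N' Zc).1) = tclosure L N' (Z0 M t) := by
  classical
  rw [tclosure_eq_biUnion_tcomps]
  ext x
  simp only [Finset.mem_biUnion, tclosureDom_val]
  constructor
  · rintro ⟨Zc, hZc, hx⟩
    exact ⟨Zc.1, mem_compsD.1 hZc, hx⟩
  · rintro ⟨K, hK, hx⟩
    obtain ⟨a, ha, rfl⟩ := mem_tcomps.1 hK
    exact ⟨compAt t ha, mem_compsD.2 hK, hx⟩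

variable (L M) in
/-- **The right-hand side of (2.26) for a term (𝐃, P) of H(Z), ON THE TORUS**, without its last factor exp O(1)α₅|Z| —
(2.26) p. 17, verbatim: *"|(2.14)| ≦ exp(−(κ₁ − 1)(LM)⁻⁴|Z∖Z′₀|)[Π_{Y∈𝐃} 2E₀ε₁C₁α₄⁻¹M^q exp C₂κ₁ exp(−(1 −
3δ)κd_k(Y))] exp(−½γ₂(ε₁²/g_k²)|P|) · exp O(1)α₅|Z|"*: e^{−(κ₁−1)·#LM-cubes of Z∖Z′₀} · Π_{Y∈𝐃} α₆ε₂e^{−(1−3δ)κ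
torusTreeLen Y} · e^{−(a/2)|P|} (a = γ₂ε₁²/g_k², α₆ε₂ = the printed bracket constant), Z′₀ = `tclosure L N′ Z₀`; window
version `B13Lemma3WindowTerms.weight`. [cite: Balaban1988RG2Cluster, (2.26) p.17] -/
def weight (c : B13.Consts) (Z : TDom d N') (a : ℝ) (t : Finset (TDom d (L * N')) × Finset (TBond d M (L * N'))) : ℝ :=
  Real.exp (-((c.κ₁ - 1) * ((Z.1 \ tclosure L N' (Z0 M t)).card : ℝ))) *
    ((∏ Y ∈ t.1, (c.α₆ * c.eps2 * Real.exp (-((1 - 3 * c.δ) * c.κ * (tsys d (L * N')).dj Y)))) *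
      Real.exp (-(a / 2 * (t.2.card : ℝ))))

omit [NeZero M] in
/-- The (2.26)-weights are non-negative. [cite: Balaban1988RG2Cluster, (2.26) p.17] -/
theorem weight_nonneg (c : B13.Consts) (Z : TDom d N') (a : ℝ) (hA : 0 ≤ c.α₆ * c.eps2)
    (t : Finset (TDom d (L * N')) × Finset (TBond d M (L * N'))) : 0 ≤ weight L M c Z a t :=
  mul_nonneg (Real.exp_nonneg _)
    (mul_nonneg (Finset.prod_nonneg fun _ _ => mul_nonneg hA (Real.exp_nonneg _)) (Real.exp_nonneg _))

variable (L N') in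
/-- The closure-union Z′₀ = ∪_{Z_i ∈ A} Z′_i of a set A of 𝐃_k-domains of the fine torus (p. 19). [cite: Balaban1988RG2Cluster, p.19 (the Z′_i)] -/
def clSet (A : Finset (TDom d (L * N'))) : Finset (TPt d N') := A.biUnion fun Zc => (tclosureDom L N' Zc).1

variable (L) in
open Classical in
/-- The admissible sets of components at fixed Z: non-empty, with closure-union Z′₀ ⊆ Z (p. 14 / p. 20 *"Finally we sum
over all Z′₀ ⊂ Z"*). [cite: Balaban1988RG2Cluster, (2.9) p.14 and p.17 (resummation order)] -/
def admA (Z : TDom d N') : Finset (Finset (TDom d (L * N'))) :=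
  (Finset.univ : Finset (TDom d (L * N'))).powerset.filter fun A => A.Nonempty ∧ clSet L N' A ⊆ Z.1

open Classical in
/-- Membership in `admA`; private plumbing. [folklore] -/
private theorem mem_admA {Z : TDom d N'} {A : Finset (TDom d (L * N'))} :
    A ∈ admA L Z ↔ A.Nonempty ∧ clSet L N' A ⊆ Z.1 := by
  simp [admA]

/-- A member of `terms` is a term; private plumbing. [folklore] -/
private theorem isTerm_of_mem_terms {Z : TDom d N'} {t : Finset (TDom d (L * N')) × Finset (TBond d M (L * N'))}
    (ht : t ∈ terms L M Z) : IsTerm L M Z t :=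
  mem_terms.1 ht

omit [NeZero M] in
open Classical in
/-- The components of a term form an admissible set; private plumbing. [folklore] -/
private theorem compsD_mem_admA {Z : TDom d N'} {t : Finset (TDom d (L * N')) × Finset (TBond d M (L * N'))}
    (ht : IsTerm L M Z t) : compsD M t ∈ admA L Z := by
  refine mem_admA.2 ⟨compsD_nonempty ht.2.1, ?_⟩
  unfold clSet
  rw [biUnion_closure_compsD t]
  exact ht.2.2

open Classical in
/-- **Terms ⇒ component sets** (p. 17: *"For a fixed Y₀ we sum over all 𝐃 satisfying (2.2). Next, we sum over Y₀, P
determining a fixed Z₀"*), ON THE TORUS: grouping the terms by their set A of components of Z₀ and bounding, for each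
A, the sum of the factorized weights by the product of the FULL component sums (injection `restr`, `sum_le_prod_sum`):
Σ_{terms} weight ≤ Σ_{A admissible} e^{−(κ₁−1)|Z∖Z′₀(A)|} Π_{Z_i∈A} inner(Z_i) — the content of (2.26) ⇒ (2.35) at the
level of index sets. [cite: Balaban1988RG2Cluster, p.17 (resummation order) and (2.35) p.19] -/
theorem sum_terms_le (c : B13.Consts) (a : ℝ) (hA : 0 ≤ c.α₆ * c.eps2) (Z : TDom d N') :
    ∑ t ∈ terms L M Z, weight L M c Z a t ≤
      ∑ A ∈ admA L Z, Real.exp (-((c.κ₁ - 1) * ((Z.1 \ clSet L N' A).card : ℝ))) *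
        ∏ Zc ∈ A, inner M c a Zc := by
  have hmaps : ∀ t ∈ terms L M Z, compsD M t ∈ admA L Z :=
    fun t ht => compsD_mem_admA (isTerm_of_mem_terms ht)
  rw [← Finset.sum_fiberwise_of_maps_to hmaps]
  refine Finset.sum_le_sum fun A _ => ?_
  have hfib : ∀ t ∈ (terms L M Z).filter (fun t => compsD M t = A), weight L M c Z a t =
      Real.exp (-((c.κ₁ - 1) * ((Z.1 \ clSet L N' A).card : ℝ))) *
        ((∏ Y ∈ t.1, (c.α₆ * c.eps2 * Real.exp (-((1 - 3 * c.δ) * c.κ * (tsys d (L * N')).dj Y)))) *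
          Real.exp (-(a / 2 * (t.2.card : ℝ)))) := by
    intro t ht
    obtain ⟨-, rfl⟩ := Finset.mem_filter.1 ht
    unfold weight clSet
    rw [biUnion_closure_compsD t]
  rw [Finset.sum_congr rfl hfib, ← Finset.mul_sum]
  refine mul_le_mul_of_nonneg_left ?_ (Real.exp_nonneg _)
  have hGL := sum_le_prod_sum ((terms L M Z).filter (fun t => compsD M t = A)) A (innerIdx M)
    (fun _ x => omega c a x) (fun _ _ x _ => omega_nonneg c a hA x) (fun t Zc => restr t Zc)
    (fun t ht Zc hZc => by
      obtain ⟨ht1, rfl⟩ := Finset.mem_filter.1 ht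
      exact restr_mem_innerIdx (isTerm_of_mem_terms ht1).1 hZc)
    (fun t ht t' ht' h => by
      obtain ⟨-, hA1⟩ := Finset.mem_filter.1 ht
      obtain ⟨-, hA1'⟩ := Finset.mem_filter.1 ht'
      exact eq_of_restr_eq (hA1.trans hA1'.symm) fun Zc hZc => h Zc (hA1 ▸ hZc))
    (fun t => (∏ Y ∈ t.1, (c.α₆ * c.eps2 * Real.exp (-((1 - 3 * c.δ) * c.κ * (tsys d (L * N')).dj Y)))) *
      Real.exp (-(a / 2 * (t.2.card : ℝ))))
    (fun t ht => by
      obtain ⟨-, hA1⟩ := Finset.mem_filter.1 ht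
      rw [weight_factor t c a, hA1])
  refine hGL.trans (le_of_eq (Finset.prod_congr rfl fun Zc _ => ?_))
  unfold inner
  rw [innerSum_eq]

/-! ## §6. The component sets versus the majorant: the three printed resummation levels (torus) -/

variable (L) in
open Classical in
/-- For a component C of Z′₀ (a 𝐃_{k+1}-domain of the coarse torus): the non-empty sets of 𝐃_k-domains whose closures lie
in C and cover it (p. 19: *"For each Z′_i we sum over all possible components of Z₀ determining this Z′_i. Then we sum
over all families of domains Z′_i such, that ∪Z′_i = Z′₀"*). [cite: Balaban1988RG2Cluster, p.19 (the sum over Z₀ with Z′₀ fixed)] -/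
def S2 (C : TDom d N') : Finset (Finset (TDom d (L * N'))) :=
  (Finset.univ.filter fun Zc : TDom d (L * N') => (tclosureDom L N' Zc).1 ⊆ C.1).powerset.filter fun A =>
    A.biUnion (fun Zc => (tclosureDom L N' Zc).1) = C.1

open Classical in
/-- **Level 2 of the resummation ON THE TORUS** (pp. 19–20, verbatim: *"For each Z′_i we sum over all possible
components of Z₀ determining this Z′_i. Then we sum over all families of domains Z′_i such, that ∪Z′_i = Z′₀."*): for
a component C of Z′₀, grouping the sets A by the family F = {closures} ∈ covering families of C and splitting A into
its parts with a fixed closure Z′ ∈ F: Σ_{A ∈ S2 C} Π inner ≤ famSum_{F covers C} Π_{Z′∈F} compSum_{∅ ≠ A′ ⊆ cl⁻¹Z′}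
Π inner — the `famSum ∘ compSum` of the majorant. [cite: Balaban1988RG2Cluster, p.19–20 (the sums over Z₀ and over the families Z′_i)] -/
theorem step2 (c : B13.Consts) (a : ℝ) (hA : 0 ≤ c.α₆ * c.eps2) (C : TDom d N') :
    ∑ A ∈ S2 L C, ∏ Zc ∈ A, inner M c a Zc ≤
      famSum (B13FamilySum.coveringFamilies (Finset.univ : Finset (TDom d N')) (fun Z' : TDom d N' => Z'.1) C.1)
        (fun Z' => compSum (Finset.univ.filter fun Zc : TDom d (L * N') => tclosureDom L N' Zc = Z')
          (inner M c a)) := by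
  set cl : TDom d (L * N') → TDom d N' := tclosureDom L N' with hcl
  have hmaps : ∀ A ∈ S2 L C, A.image cl ∈ B13FamilySum.coveringFamilies (Finset.univ : Finset (TDom d N'))
      (fun Z' : TDom d N' => Z'.1) C.1 := by
    intro A hA
    obtain ⟨-, hU⟩ := Finset.mem_filter.1 hA
    rw [B13FamilySum.mem_coveringFamilies]
    refine ⟨Finset.subset_univ _, ?_⟩
    rw [Finset.image_biUnion]
    exact hU
  unfold famSum
  rw [← Finset.sum_fiberwise_of_maps_to hmaps]
  refine Finset.sum_le_sum fun F _ => ?_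
  unfold compSum
  refine sum_le_prod_sum ((S2 L C).filter fun A => A.image cl = F) F
    (fun Z' => (Finset.univ.filter fun Zc : TDom d (L * N') => cl Zc = Z').powerset.erase ∅)
    (fun _ A' => ∏ Zc ∈ A', inner M c a Zc)
    (fun _ _ A' _ => Finset.prod_nonneg fun Zc _ => inner_nonneg c a hA Zc)
    (fun A Z' => A.filter fun Zc => cl Zc = Z') ?_ ?_ (fun A => ∏ Zc ∈ A, inner M c a Zc) ?_
  · -- the fibre of A over Z′ is a non-empty set of domains with closure Z′
    intro A hA Z' hZ'
    obtain ⟨-, hF⟩ := Finset.mem_filter.1 hA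
    rw [Finset.mem_erase, Finset.mem_powerset]
    constructor
    · rw [← hF] at hZ'
      obtain ⟨Zc, hZc, rfl⟩ := Finset.mem_image.1 hZ'
      exact Finset.nonempty_iff_ne_empty.1 ⟨Zc, Finset.mem_filter.2 ⟨hZc, rfl⟩⟩
    · intro Zc hZc
      exact Finset.mem_filter.2 ⟨Finset.mem_univ _, (Finset.mem_filter.1 hZc).2⟩
  · -- injectivity
    intro A hA A' hA' h
    obtain ⟨-, hF⟩ := Finset.mem_filter.1 hA
    obtain ⟨-, hF'⟩ := Finset.mem_filter.1 hA'
    ext Zc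
    constructor
    · intro hZc
      have hZ' : cl Zc ∈ F := hF ▸ Finset.mem_image_of_mem cl hZc
      have : Zc ∈ A.filter fun W => cl W = cl Zc := Finset.mem_filter.2 ⟨hZc, rfl⟩
      rw [h _ hZ'] at this
      exact (Finset.mem_filter.1 this).1
    · intro hZc
      have hZ' : cl Zc ∈ F := hF' ▸ Finset.mem_image_of_mem cl hZc
      have : Zc ∈ A'.filter fun W => cl W = cl Zc := Finset.mem_filter.2 ⟨hZc, rfl⟩
      rw [← h _ hZ'] at this
      exact (Finset.mem_filter.1 this).1
  · -- the product over A is the product over its fibres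
    intro A hA
    obtain ⟨-, hF⟩ := Finset.mem_filter.1 hA
    rw [Finset.prod_fiberwise_of_maps_to (g := cl) fun Zc hZc => hF ▸ Finset.mem_image_of_mem cl hZc]

variable (L) in
open Classical in
/-- For an admissible Z′₀ = j: the non-empty sets of 𝐃_k-domains of the fine torus with closure-union exactly j.
[cite: Balaban1988RG2Cluster, p.19 (the sum over Z₀ with Z′₀ fixed)] -/
def S1 (Z : TDom d N') (j : J Z) : Finset (Finset (TDom d (L * N'))) :=
  (Finset.univ : Finset (TDom d (L * N'))).powerset.filter fun A => A.Nonempty ∧ clSet L N' A = j.1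

/-- The closure Z′_i of a member of A is connected, hence inside ONE torus component of Z′₀ (p. 19: *"the set Z′₀ is a
union of connected components, which are localization domains from 𝐃_{k+1}"*); private plumbing. [folklore] -/
private theorem closure_subset_component {Z : TDom d N'} {j : J Z} {A : Finset (TDom d (L * N'))}
    (hA : clSet L N' A = j.1) {Zc : TDom d (L * N')} (hZc : Zc ∈ A) :
    ∃ i : I Z j, (tclosureDom L N' Zc).1 ⊆ i.1 := by
  obtain ⟨x, hx⟩ := (tclosureDom L N' Zc).2.1
  have hxj : x ∈ j.1 := hA ▸ Finset.mem_biUnion.2 ⟨Zc, hZc, hx⟩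
  have hsubj : (tclosureDom L N' Zc).1 ⊆ j.1 := fun y hy => hA ▸ Finset.mem_biUnion.2 ⟨Zc, hZc, hy⟩
  exact ⟨⟨tcomp j.1 x, tcomp_mem_tcomps hxj⟩, subset_tcomp_of_tFaceConnected (tclosureDom L N' Zc).2.2 hsubj hx⟩

/-- … and in only one; private plumbing. [folklore] -/
private theorem component_unique {Z : TDom d N'} {j : J Z} {i i' : I Z j} {K : Finset (TPt d N')}
    (hK : K.Nonempty) (h : K ⊆ i.1) (h' : K ⊆ i'.1) : i = i' := by
  obtain ⟨x, hx⟩ := hK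
  exact Subtype.ext (eq_of_mem_of_mem_tcomps i.2 i'.2 (h hx) (h' hx))

open Classical in
/-- **Level 1 of the resummation ON THE TORUS** (p. 19: *"Again the set Z′₀ is a union of connected components, which
are localization domains from 𝐃_{k+1}, and we denote by Z′₀ one of the components"*; (2.37) p. 20 is a product over
the components Z′_i of Z′₀): for fixed Z′₀ = j, splitting A along the torus components i of j (injection,
`sum_le_prod_sum`) and applying `step2` per component: Σ_{A ∈ S1 j} Π inner ≤ Π_{i} famSum(…)(compSum …). [cite: Balaban1988RG2Cluster, (2.37) p.20] -/
theorem step1 (c : B13.Consts) (a : ℝ) (hA : 0 ≤ c.α₆ * c.eps2) (Z : TDom d N') (j : J Z) :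
    ∑ A ∈ S1 L Z j, ∏ Zc ∈ A, inner M c a Zc ≤
      ∏ i : I Z j, famSum (B13FamilySum.coveringFamilies (Finset.univ : Finset (TDom d N'))
          (fun Z' : TDom d N' => Z'.1) (cc Z j i))
        (fun Z' => compSum (Finset.univ.filter fun Zc : TDom d (L * N') => tclosureDom L N' Zc = Z')
          (inner M c a)) := by
  set cl : TDom d (L * N') → TDom d N' := tclosureDom L N' with hcl
  have hGL := sum_le_prod_sum (S1 L Z j) (Finset.univ : Finset (I Z j))
    (fun i => S2 L ⟨i.1, isTDom_I Z j i⟩) (fun _ A' => ∏ Zc ∈ A', inner M c a Zc)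
    (fun _ _ A' _ => Finset.prod_nonneg fun Zc _ => inner_nonneg c a hA Zc)
    (fun A i => A.filter fun Zc => (cl Zc).1 ⊆ i.1) ?_ ?_ (fun A => ∏ Zc ∈ A, inner M c a Zc) ?_
  · refine hGL.trans (Finset.prod_le_prod (fun i _ => Finset.sum_nonneg fun A' _ =>
      Finset.prod_nonneg fun Zc _ => inner_nonneg c a hA Zc) fun i _ => ?_)
    exact step2 c a hA ⟨i.1, isTDom_I Z j i⟩
  · -- the part of A over the component i covers i
    intro A hA i _
    obtain ⟨-, -, hAj⟩ := Finset.mem_filter.1 hA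
    unfold S2
    rw [Finset.mem_filter, Finset.mem_powerset]
    constructor
    · intro Zc hZc
      exact Finset.mem_filter.2 ⟨Finset.mem_univ _, (Finset.mem_filter.1 hZc).2⟩
    · ext q
      rw [Finset.mem_biUnion]
      constructor
      · rintro ⟨Zc, hZc, hq⟩
        exact (Finset.mem_filter.1 hZc).2 hq
      · intro hq
        have hqi : q ∈ i.1 := hq
        have hqj : q ∈ j.1 := (subset_of_mem_tcomps i.2).1 hqi
        rw [← hAj] at hqj
        obtain ⟨Zc, hZc, hqZc⟩ := Finset.mem_biUnion.1 hqj
        have hsub : (cl Zc).1 ⊆ i.1 := by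
          have hsubj : (cl Zc).1 ⊆ j.1 := fun y hy => hAj ▸ Finset.mem_biUnion.2 ⟨Zc, hZc, hy⟩
          have h1 : (cl Zc).1 ⊆ tcomp j.1 q := subset_tcomp_of_tFaceConnected (cl Zc).2.2 hsubj hqZc
          rwa [tcomp_eq_of_mem_tcomps i.2 hqi] at h1
        exact ⟨Zc, Finset.mem_filter.2 ⟨hZc, hsub⟩, hqZc⟩
  · -- injectivity
    intro A hA A' hA' h
    obtain ⟨-, -, hAj⟩ := Finset.mem_filter.1 hA
    obtain ⟨-, -, hAj'⟩ := Finset.mem_filter.1 hA'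
    ext Zc
    constructor
    · intro hZc
      obtain ⟨i, hi⟩ := closure_subset_component hAj hZc
      have : Zc ∈ A.filter fun W => (cl W).1 ⊆ i.1 := Finset.mem_filter.2 ⟨hZc, hi⟩
      rw [h i (Finset.mem_univ _)] at this
      exact (Finset.mem_filter.1 this).1
    · intro hZc
      obtain ⟨i, hi⟩ := closure_subset_component hAj' hZc
      have : Zc ∈ A'.filter fun W => (cl W).1 ⊆ i.1 := Finset.mem_filter.2 ⟨hZc, hi⟩
      rw [← h i (Finset.mem_univ _)] at this
      exact (Finset.mem_filter.1 this).1
  · -- the product over A is the product over the components of its parts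
    intro A hA
    obtain ⟨-, -, hAj⟩ := Finset.mem_filter.1 hA
    have hAeq : A = (Finset.univ : Finset (I Z j)).biUnion fun i => A.filter fun Zc => (cl Zc).1 ⊆ i.1 := by
      ext Zc
      rw [Finset.mem_biUnion]
      constructor
      · intro hZc
        obtain ⟨i, hi⟩ := closure_subset_component hAj hZc
        exact ⟨i, Finset.mem_univ _, Finset.mem_filter.2 ⟨hZc, hi⟩⟩
      · rintro ⟨i, -, hZc⟩
        exact (Finset.mem_filter.1 hZc).1
    have hdisj : ((Finset.univ : Finset (I Z j)) : Set (I Z j)).PairwiseDisjoint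
        fun i => A.filter fun Zc => (cl Zc).1 ⊆ i.1 := by
      intro i _ i' _ hne
      rw [Function.onFun, Finset.disjoint_left]
      intro Zc hZc hZc'
      exact hne (component_unique (cl Zc).2.1 (Finset.mem_filter.1 hZc).2 (Finset.mem_filter.1 hZc').2)
    conv_lhs => rw [hAeq]
    rw [Finset.prod_biUnion hdisj]

open Classical in
/-- **Level 0 of the resummation ON THE TORUS** (p. 20, verbatim: *"The last sum to estimate is the sum over Z′₀, or
over Z∖Z′₀"*): grouping the admissible component sets by their closure-union Z′₀ = j ∈ `B13Lemma3Torus.J Z` (the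
factor e^{−(κ₁−1)|Z∖Z′₀|} is constant on the group, |Z∖Z′₀| = `wZ Z j`) and applying `step1`: Σ_{A admissible} e^{…}
Π inner ≤ Σ_j e^{−(κ₁−1)|wZ j|} Π_i famSum … — the majorant of `B13Lemma3Torus.bound238With_torus` with `inner` for
`innerSum`. [cite: Balaban1988RG2Cluster, p.20 (the sum over Z′₀)] -/
theorem sum_admA_le (c : B13.Consts) (a : ℝ) (hA : 0 ≤ c.α₆ * c.eps2) (Z : TDom d N') :
    ∑ A ∈ admA L Z, Real.exp (-((c.κ₁ - 1) * ((Z.1 \ clSet L N' A).card : ℝ))) * ∏ Zc ∈ A, inner M c a Zc ≤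
      ∑ j : J Z, Real.exp (-((c.κ₁ - 1) * ((wZ Z j).card : ℝ))) *
        ∏ i : I Z j, famSum (B13FamilySum.coveringFamilies (Finset.univ : Finset (TDom d N'))
            (fun Z' : TDom d N' => Z'.1) (cc Z j i))
          (fun Z' => compSum (Finset.univ.filter fun Zc : TDom d (L * N') => tclosureDom L N' Zc = Z')
            (inner M c a)) := by
  -- the closure-union of an admissible set, as an admissible Z′₀
  have hne : ∀ A : Finset (TDom d (L * N')), A.Nonempty → (clSet L N' A).Nonempty := by
    intro A ⟨Zc, hZc⟩
    obtain ⟨x, hx⟩ := (tclosureDom L N' Zc).2.1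
    exact ⟨x, Finset.mem_biUnion.2 ⟨Zc, hZc, hx⟩⟩
  set jOf : Finset (TDom d (L * N')) → J Z := fun A =>
    if h : A.Nonempty ∧ clSet L N' A ⊆ Z.1 then ⟨clSet L N' A, h.2, hne A h.1⟩
    else ⟨Z.1, subset_rfl, Z.2.1⟩ with hjOf
  have hjOf_val : ∀ A ∈ admA L Z, (jOf A).1 = clSet L N' A := by
    intro A hA
    have h := mem_admA.1 hA
    simp only [hjOf, dif_pos h]
  rw [← Finset.sum_fiberwise (admA L Z) jOf]
  refine Finset.sum_le_sum fun j _ => ?_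
  have hfib : ∀ A ∈ (admA L Z).filter (fun A => jOf A = j),
      Real.exp (-((c.κ₁ - 1) * ((Z.1 \ clSet L N' A).card : ℝ))) * ∏ Zc ∈ A, inner M c a Zc =
      Real.exp (-((c.κ₁ - 1) * ((wZ Z j).card : ℝ))) * ∏ Zc ∈ A, inner M c a Zc := by
    intro A hA
    obtain ⟨hA1, hAj⟩ := Finset.mem_filter.1 hA
    have : clSet L N' A = j.1 := by rw [← hjOf_val A hA1, hAj]
    rw [this]
    rfl
  rw [Finset.sum_congr rfl hfib, ← Finset.mul_sum]
  refine mul_le_mul_of_nonneg_left ?_ (Real.exp_nonneg _)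
  have hsub : (admA L Z).filter (fun A => jOf A = j) ⊆ S1 L Z j := by
    intro A hA
    obtain ⟨hA1, hAj⟩ := Finset.mem_filter.1 hA
    unfold S1
    rw [Finset.mem_filter, Finset.mem_powerset]
    exact ⟨Finset.subset_univ _, (mem_admA.1 hA1).1, by rw [← hjOf_val A hA1, hAj]⟩
  exact (Finset.sum_le_sum_of_subset_of_nonneg hsub fun A _ _ =>
    Finset.prod_nonneg fun Zc _ => inner_nonneg c a hA Zc).trans (step1 c a hA Z j)

/-! ## §7. The theorems: (2.26) for every term ⇒ the majorant `hrep`; Lemma 3 (2.38) and §2 on the torus from (2.26)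
per term and numbers -/

open Classical in
/-- **The (2.26)-weights of ALL terms of H(Z), summed, are bounded by the majorant `hrep` of
`B13Lemma3Torus.bound238With_torus`** — the printed resummation order p. 17 (*"For a fixed Y₀ we sum over all 𝐃
satisfying (2.2). Next, we sum over Y₀, P determining a fixed Z₀. Further, for a fixed Z′₀, we sum over all possible
Z₀ determining this fixed Z′₀. Finally we sum over all Z′₀ ⊂ Z."*) realized ON THE TORUS as the injection of the term
set into the nested index sets of the majorant (`sum_terms_le`, `sum_admA_le`). [cite: Balaban1988RG2Cluster, p.17 (resummation order)] -/
theorem sum_weight_le_majorant (c : B13.Consts) (a : ℝ) (hA : 0 ≤ c.α₆ * c.eps2) (Z : TDom d N') :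
    ∑ t ∈ terms L M Z, weight L M c Z a t ≤
      ∑ j : J Z, Real.exp (-((c.κ₁ - 1) * ((wZ Z j).card : ℝ))) *
        ∏ i : I Z j, famSum (B13FamilySum.coveringFamilies (Finset.univ : Finset (TDom d N'))
            (fun Z' : TDom d N' => Z'.1) (cc Z j i))
          (fun Z' => compSum (Finset.univ.filter fun Zc : TDom d (L * N') => tclosureDom L N' Zc = Z')
            (fun Zc => innerSum (Finset.univ : Finset (TDom d (L * N'))) (fun Y : TDom d (L * N') => Y.1)
              (tsys d (L * N')).dj Zc.1 (ttouch M (L * N')) (tavail M (L * N') Zc)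
              (c.α₆ * c.eps2) ((1 - 3 * c.δ) * c.κ) a)) :=
  (sum_terms_le c a hA Z).trans (sum_admA_le c a hA Z)

open Classical in
/-- **(2.26) FOR EVERY TERM ⇒ the hypothesis `hrep`** of `B13Lemma3Torus.bound238With_torus` /
`B13Lemma3Assembly.bound238With_of_226` ON THE TORUS: if on the space of p. 15 the activity is dominated by its terms,
‖H(Z)‖ ≤ Σ_{t ∈ terms Z} ‖T_t‖ (e.g. H(Z) = Σ_t T_t, (2.9)/(2.14)), and every term obeys (2.26) — ‖T_t‖ ≤
weight(t)·e^{a₅·#LM-cubes of Z} (p. 17; a₅ = O(1)(LM)⁴α₅, p. 20) — then ‖H(Z)‖ ≤ e^{a₅|Z|}·(majorant). [cite: Balaban1988RG2Cluster, (2.26) p.17] -/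
theorem hrep_of_termwise (c : B13.Consts) {a a₅ : ℝ} (hA : 0 ≤ c.α₆ * c.eps2) (W : TwoTorusStep d L N')
    (T : (Z : TDom d N') → Finset (TDom d (L * N')) × Finset (TBond d M (L * N')) → W.Φ → ℂ)
    (hH : ∀ (Z : TDom d N') (φ : W.Φ), φ ∈ W.sp2 Z → ‖W.H Z φ‖ ≤ ∑ t ∈ terms L M Z, ‖T Z t φ‖)
    (h226 : ∀ (Z : TDom d N') (φ : W.Φ), φ ∈ W.sp2 Z → ∀ t ∈ terms L M Z,
      ‖T Z t φ‖ ≤ weight L M c Z a t * Real.exp (a₅ * ((Z.1).card : ℝ))) :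
    ∀ (Z : TDom d N') (φ : W.Φ), φ ∈ W.sp2 Z → ‖W.H Z φ‖ ≤
      Real.exp (a₅ * ((Z.1).card : ℝ)) *
      ∑ j : J Z, Real.exp (-((c.κ₁ - 1) * ((wZ Z j).card : ℝ))) *
        ∏ i : I Z j, famSum (B13FamilySum.coveringFamilies (Finset.univ : Finset (TDom d N'))
            (fun Z' : TDom d N' => Z'.1) (cc Z j i))
          (fun Z' => compSum (Finset.univ.filter fun Zc : TDom d (L * N') => tclosureDom L N' Zc = Z')
            (fun Zc => innerSum (Finset.univ : Finset (TDom d (L * N'))) (fun Y : TDom d (L * N') => Y.1)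
              (tsys d (L * N')).dj Zc.1 (ttouch M (L * N')) (tavail M (L * N') Zc)
              (c.α₆ * c.eps2) ((1 - 3 * c.δ) * c.κ) a)) := by
  intro Z φ hφ
  calc ‖W.H Z φ‖ ≤ ∑ t ∈ terms L M Z, ‖T Z t φ‖ := hH Z φ hφ
    _ ≤ ∑ t ∈ terms L M Z, weight L M c Z a t * Real.exp (a₅ * ((Z.1).card : ℝ)) :=
        Finset.sum_le_sum fun t ht => h226 Z φ hφ t ht
    _ = Real.exp (a₅ * ((Z.1).card : ℝ)) * ∑ t ∈ terms L M Z, weight L M c Z a t := by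
        rw [Finset.mul_sum]
        exact Finset.sum_congr rfl fun t _ => mul_comm _ _
    _ ≤ _ := mul_le_mul_of_nonneg_left (sum_weight_le_majorant c a hA Z) (Real.exp_nonneg _)

open Classical in
/-- **Lemma 3 (2.38) AS PRINTED on the two-scale TORUS model, from (2.26) FOR EVERY TERM and the restrictions on the
constants only.**  Lemma 3 p. 20, verbatim: *"Under all the above restrictions on the constants M, κ, κ₁, α₀, α₁, α₄,
α₆, γ₂, γ, ε₁, the activity H(Z) for a localization domain Z ∈ 𝐃_{k+1} satisfies the inequality |H(Z)| ≦ C₃ε₁ exp(−(1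
− 8δ)½Lκd_{k+1}(Z)). (2.38)"*  For two-torus step data (`B13Lemma3Torus.TwoTorusStep`, d = 4, L = `c.L` ≥ 8, unit torus
with M·L·N′ sites per direction): termwise domination `hH` + (2.26) per term `h226` + the numerical restrictions of
`B13Lemma3Torus.bound238_torus` ⇒ `B13.Bound238 W.toStepData c`.  What remains by assertion is exactly the analytic
content (2.15)–(2.26) of the printed proof (and the representation of H(Z) by its terms, (2.9)/(2.14)); every
resummation, geometric and combinatorial step of pp. 17–20 is a theorem on the papers' periodic carrier.  Window version
`B13Lemma3WindowTerms.bound238_window_of_226`. [cite: Balaban1988RG2Cluster, Lemma 3 (2.38) p.20] -/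
theorem bound238_torus_of_226 (c : B13.Consts) (hL : 8 ≤ c.L) (hLc : c.L = L) (W : TwoTorusStep 4 L N')
    (T : (Z : TDom 4 N') → Finset (TDom 4 (L * N')) × Finset (TBond 4 M (L * N')) → W.Φ → ℂ)
    {a a₂ a₂' a₅ Aabs : ℝ}
    (hH : ∀ (Z : TDom 4 N') (φ : W.Φ), φ ∈ W.sp2 Z → ‖W.H Z φ‖ ≤ ∑ t ∈ terms L M Z, ‖T Z t φ‖)
    (h226 : ∀ (Z : TDom 4 N') (φ : W.Φ), φ ∈ W.sp2 Z → ∀ t ∈ terms L M Z,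
      ‖T Z t φ‖ ≤ weight L M c Z a t * Real.exp (a₅ * ((Z.1).card : ℝ)))
    (hα₆ : 0 < c.α₆) (hε₀ : 0 ≤ c.eps2) (hδ : 0 ≤ c.δ) (hδ7 : 0 ≤ 1 - 7 * c.δ) (hκ : 0 ≤ c.κ) (ha : 0 ≤ a)
    (hR15 : c.R15) (hR16 : 18 * ((1 - 4 * c.δ) * c.κ) ≤ a / 20) (hR16' : 4 * c.κ ≤ a / 20)
    (hR17 : Real.exp (-(a / 20)) ≤ c.eps2) (h231 : 2 * (4 : ℝ) * (M : ℝ) ^ 4 * Real.exp (-(a / 10)) ≤ a / 20)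
    (ha₂ : 0 ≤ a₂) (hκ229 : kappa₀ 64 8 + a₂ ≤ c.δ * c.κ)
    (hsm229 : c.α₆ * Real.exp a₂ * K₀ 64 8 * 64 ≤ a₂)
    (habsk : Real.exp (-(a / 20)) * 64 ≤ c.δ * c.κ)
    (h18half : B13Step237.R18half c (K₀ 64 8 * Real.exp (Real.exp (-(a / 20)) * 64)))
    (h18 : B13Step237.R18sharp c (K₀ 64 8 * Real.exp (Real.exp (-(a / 20)) * 64)) ((c.L : ℝ) / 2))
    (ha₂' : 0 ≤ a₂') (hκ229' : kappa₀ 64 8 + a₂' ≤ c.δ * ((c.L : ℝ) / 2) * c.κ)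
    (hsm229' : c.α₆ * Real.exp a₂' * K₀ 64 8 * 64 ≤ a₂')
    (hR20 : 18 * ((1 - 7 * c.δ) * ((c.L : ℝ) / 2) * c.κ) ≤ (c.κ₁ - 1) / 2)
    (ha₅ : 0 ≤ a₅) (habs : a₅ + Real.exp (-((c.κ₁ - 1) / 2)) ≤ Aabs)
    (hAc : Aabs * 64 ≤ c.δ * ((c.L : ℝ) / 2) * c.κ)
    (hC3 : B13Step237.bracketF c (K₀ 64 8 * Real.exp (Real.exp (-(a / 20)) * 64)) / c.α₆ *
      Real.exp (Aabs * 64) ≤ c.C3act * c.ε₁) :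
    B13.Bound238 W.toStepData c :=
  bound238_torus c hL hLc W M (hrep_of_termwise c (mul_nonneg hα₆.le hε₀) W T hH h226)
    hα₆ hε₀ hδ hδ7 hκ ha hR15 hR16 hR16' hR17 h231 ha₂ hκ229 hsm229 habsk h18half h18 ha₂' hκ229' hsm229' hR20 ha₅
    habs hAc hC3

open Classical in
/-- **§2 of the paper END TO END on the two-scale TORUS model from the TERMWISE (2.26)**, at the printed ℓ = ½L
(L ≥ 8): termwise domination `hH` + (2.26) per term `h226` + the representation (2.13) over `TTouch` + the space
restriction + the UNPRINTED log Z^{(k)} leaf + (I.1.7) / analyticity / gauge invariance + numbers ⇒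
`B13.Deliverables W.toStepData c` — `hrep_of_termwise` fed into `B13Lemma3Torus.deliverables_torus_of_226`.  Window
version `B13Lemma3WindowChain.deliverables_window_of_226`. [cite: Balaban1988RG2Cluster, pp.17–22 (Lemma 3 to Theorem I.3)] -/
theorem deliverables_torus_termwise_of_226 (c : B13.Consts) (hL : 8 ≤ c.L) (hLc : c.L = L) (W : TwoTorusStep 4 L N')
    (T : (Z : TDom 4 N') → Finset (TDom 4 (L * N')) × Finset (TBond 4 M (L * N')) → W.Φ → ℂ)
    {a a₂ a₂' a₅ Aabs : ℝ}
    (hH : ∀ (Z : TDom 4 N') (φ : W.Φ), φ ∈ W.sp2 Z → ‖W.H Z φ‖ ≤ ∑ t ∈ terms L M Z, ‖T Z t φ‖)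
    (h226 : ∀ (Z : TDom 4 N') (φ : W.Φ), φ ∈ W.sp2 Z → ∀ t ∈ terms L M Z,
      ‖T Z t φ‖ ≤ weight L M c Z a t * Real.exp (a₅ * ((Z.1).card : ℝ)))
    (hα₆ : 0 < c.α₆) (hε₀ : 0 ≤ c.eps2) (hδ : 0 ≤ c.δ) (hδ7 : 0 ≤ 1 - 7 * c.δ) (hκ : 0 ≤ c.κ) (ha : 0 ≤ a)
    (hR15 : c.R15) (hR16 : 18 * ((1 - 4 * c.δ) * c.κ) ≤ a / 20) (hR16' : 4 * c.κ ≤ a / 20)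
    (hR17 : Real.exp (-(a / 20)) ≤ c.eps2) (h231 : 2 * (4 : ℝ) * (M : ℝ) ^ 4 * Real.exp (-(a / 10)) ≤ a / 20)
    (ha₂ : 0 ≤ a₂) (hκ229 : kappa₀ 64 8 + a₂ ≤ c.δ * c.κ)
    (hsm229 : c.α₆ * Real.exp a₂ * K₀ 64 8 * 64 ≤ a₂)
    (habsk : Real.exp (-(a / 20)) * 64 ≤ c.δ * c.κ)
    (h18half : B13Step237.R18half c (K₀ 64 8 * Real.exp (Real.exp (-(a / 20)) * 64)))
    (h18 : B13Step237.R18sharp c (K₀ 64 8 * Real.exp (Real.exp (-(a / 20)) * 64)) ((c.L : ℝ) / 2))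
    (ha₂' : 0 ≤ a₂') (hκ229' : kappa₀ 64 8 + a₂' ≤ c.δ * ((c.L : ℝ) / 2) * c.κ)
    (hsm229' : c.α₆ * Real.exp a₂' * K₀ 64 8 * 64 ≤ a₂')
    (hR20 : 18 * ((1 - 7 * c.δ) * ((c.L : ℝ) / 2) * c.κ) ≤ (c.κ₁ - 1) / 2)
    (ha₅ : 0 ≤ a₅) (habs : a₅ + Real.exp (-((c.κ₁ - 1) / 2)) ≤ Aabs)
    (hAc : Aabs * 64 ≤ c.δ * ((c.L : ℝ) / 2) * c.κ)
    (hC3 : B13Step237.bracketF c (K₀ 64 8 * Real.exp (Real.exp (-(a / 20)) * 64)) / c.α₆ *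
      Real.exp (Aabs * 64) ≤ c.C3act * c.ε₁)
    (hsp : ∀ X Z : (tsys 4 N').Dom, ∀ φ, Z.1 ⊆ X.1 → φ ∈ W.sp2 X → φ ∈ W.sp2 Z)
    (h213 : ∀ X : (tsys 4 N').Dom, ∀ φ, φ ∈ W.sp2 X →
      W.Ek1 X φ = locE (TTouch (d := 4) (N := N')) (fun Z : (tsys 4 N').Dom => Z.1) (fun Z => W.H Z φ) X.1)
    (hAct : 0 ≤ c.C3act * c.ε₁)
    (hlarge : c.κ + 2 * (64 * Real.log 162) + 2 ≤ (1 - 8 * c.δ) * ((c.L : ℝ) / 2) * c.κ)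
    (hsmall : c.C3act * c.ε₁ * Real.exp (5 * c.κ + 1) * K₀ 64 8 * 9 * 64 ≤ 1)
    (hA₂ : Real.exp 1 * 9 * 64 * K₀ 64 8 ^ 2 ≤ c.A₂)
    (hR : W.Restr) (h22 : c.R22) (h23 : c.R23) (h24 : c.R24sharp) (hE₀ : 0 ≤ c.E₀) {Bc : ℝ} (hBc : 0 ≤ Bc)
    (hlog : B13.LogHalfBound W.toStepData.Dk1 W.toStepData.sp2 W.toStepData.Elog (fun X => X.1.card) Bc (c.δ₀ * c.M))
    (hE₀def : Bc * 64 ≤ c.E₀ / 2) (hrepr : W.Repr17)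
    (han : ∀ X, W.Analytic (W.toStepData.Etot X) (W.sp2 X))
    (hg : ∀ X, W.GaugeInv (W.toStepData.Etot X)) :
    B13.Deliverables W.toStepData c :=
  deliverables_torus_of_226 c hL hLc W M (hrep_of_termwise c (mul_nonneg hα₆.le hε₀) W T hH h226)
    hα₆ hε₀ hδ hδ7 hκ ha hR15 hR16 hR16' hR17 h231 ha₂ hκ229 hsm229 habsk h18half h18 ha₂' hκ229' hsm229' hR20 ha₅
    habs hAc hC3 hsp h213 hAct hlarge hsmall hA₂ hR h22 h23 h24 hE₀ hBc hlog hE₀def hrepr han hg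

end TwoTori

end

end Literature.MathematicalPhysics.QuantumFieldTheory.Balaban1983to89.B13Lemma3TorusTerms
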